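/-
Copyright (c) 2026 the pub-hodgecm-mathlib formalisation cell (harness21).  Prover seat hodgecm-mathlib-LH4-p11 (g8), req620 Track A «(D-RAM) FOUR-FRAME» squad, helper lane on
h413 = stmt-HodgeConjecture-24833 (count-neutral).  Dealer∕pen LH4-plan (g13) WORD #96 (2) «LH4-p11 OWNS THE PURE CELLS»; SIG-PureCells v1 (9a3f5135) §1∕§2, FILE 2b.  2026-09-04.
-/
import Summits.HodgeConjecture.HodgeConjecture.Theorems.F0P3cDyRamLabelledOddValueOfKappa        -- FILE 2a (this seat): `labelledOddCount_div_relIndex_eq_normSign_mul_kappaCount_of_fst_small`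
import Summits.HodgeConjecture.HodgeConjecture.Theorems.F0P3cDyRamLabelledKappaGluedStratum      -- ★ (LH4-p09 (g8)): brings ★ κG1 socket `finsum_kappaCount_mul_stabiliserWeight_hasAxis_G1`, ★ p859257 G1 token reads, ★ `stratum_G1_eq`
import Summits.HodgeConjecture.HodgeConjecture.Theorems.F0P3cDyRamDiagonalGluedSocket             -- ★ B56 (LH4-p08): `finsum_stabiliserWeight_hasAxis_G1`
import Summits.HodgeConjecture.HodgeConjecture.Theorems.F0P3cDyRamDiagonalHNFDualFrameValues      -- ★ (3c-i) (LH4-p10∕F0P3a-p01): `dualFrame_values`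
import Summits.HodgeConjecture.HodgeConjecture.Theorems.F0P3cDyRamLabelledOddStageAOfRecord      -- ★ p860462 (this seat): brings ★ `finite_unitTorus_orbit_of_mem_normalisedStableLattices`
import Summits.HodgeConjecture.HodgeConjecture.Theorems.F0P3cDyRamStableCountTypeZero             -- ★ (LH4-p12): `v_diag_eq_one`, `diag_regular`
import Summits.HodgeConjecture.HodgeConjecture.Theorems.F0P3cDyRamStageOneBDefs                  -- ★ DEFS №5: `mcOfRecord`; brings `mstarOfRecord`
import HarnessLib

/-!
# Crux `H413`, line LH4 «(D-RAM) FOUR-FRAME» — (β-BAL) Stage B, THE PURE STRATA, FILE 2b: the GLUED strata `G₁ = (2ρ, 2ρ+s, 2ρ+s)` in the one-slot cell `2ρ + m* ≤ n₂`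
# `Σᶠ_{M ∈ stratum G₁, clean shell} labelledOddCount σ ϖ 0 i Λ M ∕ [𝒰 : N(S̃′(M))] = [2ρ+s+ℓ₀ = n₁ ∧ 2∣s ∧ 2ρ ≤ min n₂ n₃] · ω(e_B)∕2 · (0, (q−1)q^{2ρ+s∕2−1}, ω(−1)q^{2ρ+s∕2−1}((q−1)[2d ≤ s] − [s+2 = 2d]))_i`

Cell `hodgecm-mathlib` (D-0151), FLOOR 0, crux item H413 = `stmt-HodgeConjecture-24833`, route `HCCMUnconditional`; squad F0∕P3c∕LH4.  THEOREMS ONLY (no `def`, no instance, no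
notation, no `sorry`, default heartbeats); ★-only imports; lane `--supports stmt-HodgeConjecture-24833 --as helper` (count-neutral); pays NO row, states NO law.
THE MATHEMATICS (SIG-PureCells v1 §1 row G₁; LH4-p05 (g8)'s box currency).  A member of the stratum is the glued normal form `latt (1 0 0; x ϖ^ρ 0; xζ+y″ ϖ^ρζ ϖ^{2ρ+s})`
(★ `stratum_G1_eq`), `s` even, with polarisation valuations `|D₀| = exp 2ρ`, `|D₁| = exp(2ρ+s)` (§1, ★ `dualFrame_values`).  In the cell the slot-`0` label term is `ϖ^{m*}`-small,
the three shell tokens read the constant `2ρ + s + ℓ₀ = n₁` (§2: off the glue foot ★ `depths_of_mapGL_latt_hnf_glued_eq` + ★ p859257 reads, square token automatic; on the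
foot the stratum sits inside level `ℓ₀+1`), FILE 2a gives `ω(e_B)∕2·(κ₂, 1, κ₀)_i·stabiliserWeight` pointwise, and ★ κG1 ∕ ★ B56 sum over the stratum (glue branch void).  A
TOKEN-FREE twin gives `0` off the read (LH4-p05 (g8) parity ask).  HONEST LABEL: count-neutral; SIG-B2b3, (β-BAL), (β), T₊ OPEN; `HC_CM` is proved only modulo the 7 printed
citations (2 remaining named inputs: hLiu418 = `stmt-HodgeConjecture-24832`, h413 = `stmt-HodgeConjecture-24833`) until rung 0 closes.
References: [Kottwitz1986BaseChangeUnits] §1 pp. 240–241 · [Rogawski1990] §4.9 Prop. 4.9.1 (a)(b) p. 55, §4.10 p. 58 · [LanglandsShelstad1987] §3 · [Jacobowitz1962] §4, §7.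
-/

set_option autoImplicit false

noncomputable section

namespace Summit.HodgeConjecture.HodgeConjecture.Cruxes.H413.F0P3cDyRamLabelledOddPureStrataG1

open Matrix WithZero
open Literature.NumberTheory.Automorphic Literature.NumberTheory.Automorphic.HermitianLattice
open Literature.NumberTheory.Automorphic.UnitaryLatticeTree Literature.NumberTheory.Automorphic.UnitaryThreeFourFrame
open Literature.NumberTheory.LocalFields Literature.NumberTheory.LocalFields.WildQuadraticDatum
open Summit.HodgeConjecture.HodgeConjecture.Cruxes.H413.F0P3cDyRamFourFramePieces
open Summit.HodgeConjecture.HodgeConjecture.Cruxes.H413.F0P3cDyRamFourFrameCensusDefs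
open Summit.HodgeConjecture.HodgeConjecture.Cruxes.H413.F0P3cDyRamStageOneBDefs (mcOfRecord)
open Summit.HodgeConjecture.HodgeConjecture.Cruxes.H413.F0P3cDyRamDiagonalTorusDefs
open Summit.HodgeConjecture.HodgeConjecture.Cruxes.H413.F0P3cDyRamDiagonalStrataDefs
open Summit.HodgeConjecture.HodgeConjecture.Cruxes.H413.F0P3cDyRamDiagonalKappaCountDefs
open Summit.HodgeConjecture.HodgeConjecture.Cruxes.H413.F0P3cDyRamLabelledOddCountDefs
open Summit.HodgeConjecture.HodgeConjecture.Cruxes.H413.F0P3cDyRamDiagonalGluedStratum (stratum_G1_eq two_dvd_of_mem_stratum_G1)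
open Summit.HodgeConjecture.HodgeConjecture.Cruxes.H413.F0P3cDyRamDiagonalGluedStability (depths_of_mapGL_latt_hnf_glued_eq)
open Summit.HodgeConjecture.HodgeConjecture.Cruxes.H413.F0P3cDyRamDiagonalKappaGluedSocket (finsum_kappaCount_mul_stabiliserWeight_hasAxis_G1)
open Summit.HodgeConjecture.HodgeConjecture.Cruxes.H413.F0P3cDyRamDiagonalGluedSocket (finsum_stabiliserWeight_hasAxis_G1)
open Summit.HodgeConjecture.HodgeConjecture.Cruxes.H413.F0P3cDyRamDiagonalHNFDualFrameValues (dualFrame_values)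
open Summit.HodgeConjecture.HodgeConjecture.Cruxes.H413.F0P3cDyRamLabelledGluedStratumRead (latticeInLevel_diagonal_latt_G1_iff latticeInLevel_diagonal_latt_G1_iff_of_ne)
open Summit.HodgeConjecture.HodgeConjecture.Cruxes.H413.F0P3cDyRamLabelledSplitStrata (finsum_mem_sep_eq_ite_of_forall_iff)
open Summit.HodgeConjecture.HodgeConjecture.Cruxes.H413.F0P3cDyRamLabelledKappaSplitStrata (v_le_pow_iff_of_eq v_mul_self_le_pow_iff_of_eq)
open Summit.HodgeConjecture.HodgeConjecture.Cruxes.H413.F0P3cDyRamStableCountTypeZero (v_diag_eq_one diag_regular)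
open Summit.HodgeConjecture.HodgeConjecture.Cruxes.H413.F0P3cDyRamDiagonalOrbitFibreCountHeads (finite_unitTorus_orbit_of_mem_normalisedStableLattices)
open Summit.HodgeConjecture.HodgeConjecture.Cruxes.H413.F0P3cDyRamLabelledOddValueOfKappa
open scoped Valued WithZero Matrix MatrixGroups

variable {K : Type} [Field K] [Valued K ℤᵐ⁰]

/-! ## §1  The polarisation valuations on the glued normal form -/

/-- **POLARISATION VALUATIONS ON THE GLUED NORMAL FORM**: if `latt (1 0 0; x ϖ^ρ 0; xζ+y″ ϖ^ρζ ϖ^{2ρ+s})` (`|x| = |ζ| = 1`, `|y″| = |ϖ|^s`, `ρ, s ≥ 1`, normalised) is a type-`0` vertex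
lattice of `diag(D)` (`D_i ≠ 0`), then `|D₀| = exp 2ρ` and `|D₁| = exp(2ρ+s)` (★ `dualFrame_values`: `|xz − yϖ^ρ| = |y″|·|ϖ|^ρ`, the maxima are attained at the deep terms).
[cite: Jacobowitz1962, §4, §7] [cite: Kottwitz1986BaseChangeUnits, §1 pp. 240–241] -/
theorem v_polarisation_latt_G1 {σ : K →+* K} (hvσ : ∀ a, Valued.v (σ a) = Valued.v a) {ϖ : K} (hϖ : Valued.v ϖ = WithZero.exp (-1 : ℤ))
    {D : Fin 3 → K} (hD0 : ∀ i, D i ≠ 0) {ρ s : ℕ} (hρ : 1 ≤ ρ) (hs : 1 ≤ s) {x ζ y'' : K} (hx : Valued.v x = 1) (hζ : Valued.v ζ = 1)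
    (hy : Valued.v y'' = Valued.v ϖ ^ s)
    (hn : IsNormalisedLattice (latt (!![1, 0, 0; x, ϖ ^ ρ, 0; x * ζ + y'', ϖ ^ ρ * ζ, ϖ ^ (2 * ρ + s)] : Matrix (Fin 3) (Fin 3) K)))
    (hM : IsVertexLattice σ ϖ (Matrix.diagonal D) 0 (latt (!![1, 0, 0; x, ϖ ^ ρ, 0; x * ζ + y'', ϖ ^ ρ * ζ, ϖ ^ (2 * ρ + s)] : Matrix (Fin 3) (Fin 3) K))) :
    Valued.v (D 0) = WithZero.exp ((2 * ρ : ℕ) : ℤ) ∧ Valued.v (D 1) = WithZero.exp ((2 * ρ + s : ℕ) : ℤ) := by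
  have hϖ1 : Valued.v ϖ < 1 := by rw [hϖ, ← WithZero.exp_zero, WithZero.exp_lt_exp]; norm_num
  have hq : ∀ n : ℕ, Valued.v (ϖ ^ n) = WithZero.exp (-(n : ℤ)) := fun n => by rw [map_pow, v_varpi_pow hϖ]
  have hform : (!![1, 0, 0; x, ϖ ^ ρ, 0; x * ζ + y'', ϖ ^ ρ * ζ, ϖ ^ (2 * ρ + s)] : Matrix (Fin 3) (Fin 3) K) =
      Matrix.of ![![1, 0, 0], ![x, ϖ ^ ρ, 0], ![x * ζ + y'', ϖ ^ ρ * ζ, ϖ ^ (2 * ρ + s)]] := rfl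
  rw [hform] at hn hM
  have hxle : Valued.v x ≤ 1 := hx.le
  have hyv : Valued.v (x * ζ + y'') = 1 := by
    rw [Valuation.map_add_eq_of_lt_left _ (by rw [map_mul, hx, hζ, mul_one, hy]; exact pow_lt_one₀ zero_le hϖ1 (by omega)), map_mul, hx, hζ, mul_one]
  have hzv : Valued.v (ϖ ^ ρ * ζ) = WithZero.exp (-(ρ : ℤ)) := by rw [map_mul, hζ, mul_one, hq]
  have hzle : Valued.v (ϖ ^ ρ * ζ) ≤ 1 := by rw [hzv, ← WithZero.exp_zero, WithZero.exp_le_exp]; omega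
  obtain ⟨-, ⟨-, h1b, h1c⟩, ⟨-, -, h0b, h0c⟩⟩ := dualFrame_values hvσ hϖ hD0 ρ (2 * ρ + s) hxle hyv.le hzle hn hM
  -- `|z|·exp(ρ + (2ρ+s)) = exp(2ρ+s)` and `|xz − yϖ^ρ|·exp(ρ + (2ρ+s)) = exp(2ρ)`
  have ez : Valued.v (ϖ ^ ρ * ζ) * WithZero.exp ((ρ : ℤ) + ((2 * ρ + s : ℕ) : ℤ)) = WithZero.exp ((2 * ρ + s : ℕ) : ℤ) := by
    rw [hzv, ← WithZero.exp_add]; congr 1; push_cast; ring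
  have ew : Valued.v (x * (ϖ ^ ρ * ζ) - (x * ζ + y'') * ϖ ^ ρ) * WithZero.exp ((ρ : ℤ) + ((2 * ρ + s : ℕ) : ℤ)) = WithZero.exp ((2 * ρ : ℕ) : ℤ) := by
    rw [show x * (ϖ ^ ρ * ζ) - (x * ζ + y'') * ϖ ^ ρ = -(y'' * ϖ ^ ρ) by ring, Valuation.map_neg, map_mul, hy, ← map_pow, hq, hq,
      ← WithZero.exp_add, ← WithZero.exp_add]
    congr 1; push_cast; ring
  rw [ez] at h1b h1c
  rw [ew] at h0b h0c
  refine ⟨?_, ?_⟩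
  · rcases h0c with h | h | h
    · rw [h, ← WithZero.exp_zero, WithZero.exp_le_exp] at h0b; push_cast at h0b; omega
    · rw [h, hx, one_mul, WithZero.exp_le_exp] at h0b; push_cast at h0b; omega
    · exact h
  · rcases h1c with h | h
    · rw [h, WithZero.exp_le_exp] at h1b; push_cast at h1b; omega
    · exact h

/-! ## §2  The `G₁ = (2ρ, 2ρ+s, 2ρ+s)` stratum on the clean shell, in the one-slot cell `2ρ + m* ≤ n₂` -/

section Strata

variable [CompleteSpace K] [Fintype 𝓀[K]] {σ : K →+* K} {ϖ : K} {d t : ℕ} {α β : K} {N₀ n₁ n₂ n₃ : ℕ}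

omit [CompleteSpace K] [Fintype 𝓀[K]] in
/-- **THE CLEAN-SHELL READ ON `G₁ = (2ρ, 2ρ+s, 2ρ+s)` IN THE ONE-SLOT CELL** (token-free): for every member of the stratum, the three shell tokens of
`X = diag(α−1, β−1, 0)` hold iff `2ρ + s + ℓ₀ = n₁` (off the glue foot: ★ `depths_of_mapGL_latt_hnf_glued_eq` + ★ p859257 constant reads + the automatic square token;
on the foot `n₁ = n₂ + s` the cell puts the stratum inside level `ℓ₀ + 1`). [cite: Kottwitz1986BaseChangeUnits, §1 pp. 240–241] [cite: Rogawski1990, §4.9 Prop. 4.9.1 (a) p. 55] -/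
theorem shell_iff_of_mem_stratum_G1 (hD : IsRamifiedQuadraticDatum σ ϖ d t) (h2d : 2 ≤ d)
    (hE : IsElementDatum σ ϖ N₀ α β n₁ n₂ n₃) (hmc : mcOfRecord d ≤ N₀)
    (T : GL (Fin 3) K) (hT : (T : Matrix (Fin 3) (Fin 3) K) = Matrix.diagonal ![α, β, 1]) (ρ s : ℕ) (hρ : 1 ≤ ρ) (hs : 1 ≤ s)
    (hcell : 2 * ρ + mstarOfRecord d ≤ n₂) :
    ∀ M ∈ stratum σ ϖ T ![2 * ρ, 2 * ρ + s, 2 * ρ + s],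
      (LatticeInLevel ϖ (d % 2) (Matrix.diagonal ![α - 1, β - 1, 0]) M ∧ ¬ LatticeInLevel ϖ (d % 2 + 1) (Matrix.diagonal ![α - 1, β - 1, 0]) M ∧
          LatticeInLevel ϖ (mcOfRecord d) (Matrix.diagonal ![(α - 1) * (α - 1), (β - 1) * (β - 1), 0]) M) ↔ 2 * ρ + s + d % 2 = n₁ := by
  classical
  have hD' := hD
  obtain ⟨hσ, hvσ, hϖ, hfix, -, -, -⟩ := hD'
  have hϖ0 : ϖ ≠ 0 := fun h0 => by rw [h0, map_zero] at hϖ; exact WithZero.coe_ne_zero hϖ.symm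
  have hϖ1 : Valued.v ϖ ≤ 1 := by rw [hϖ, ← WithZero.exp_zero, WithZero.exp_le_exp]; norm_num
  have hα : Valued.v (α - 1) = Valued.v ϖ ^ n₂ := hE.2.2.2.2.2.2.1
  have hβ : Valued.v (β - 1) = Valued.v ϖ ^ n₁ := hE.2.2.2.2.2.1
  have hγ : Valued.v (α - β) = Valued.v ϖ ^ n₃ := hE.2.2.2.2.2.2.2.1
  have hn₁ : N₀ ≤ n₁ := hE.2.2.2.2.2.2.2.2.1
  have hn₂ : N₀ ≤ n₂ := hE.2.2.2.2.2.2.2.2.2.1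
  have hn₃ : N₀ ≤ n₃ := hE.2.2.2.2.2.2.2.2.2.2
  have hmcv : mcOfRecord d = 2 * ((d % 2 + 2 * d - 1 + d) / 2) := rfl
  have hmsv : mstarOfRecord d = d % 2 + 2 * d - 1 := rfl
  rw [hmsv] at hcell
  have hγ' : Valued.v (β - 1 - (α - 1)) = Valued.v ϖ ^ n₃ := by rw [show β - 1 - (α - 1) = -(α - β) by ring, Valuation.map_neg, hγ]
  have r1 := v_le_pow_iff_of_eq hD hα
  have r2 := v_le_pow_iff_of_eq hD hβ
  have r3 := v_le_pow_iff_of_eq hD hγ'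
  have hv0 : ∀ ℓ : ℕ, Valued.v (0 : K) ≤ Valued.v ϖ ^ ℓ := fun ℓ => by rw [map_zero]; exact zero_le
  have hpw : ∀ a b : ℕ, Valued.v ϖ ^ a ≤ Valued.v ϖ ^ b ↔ b ≤ a := fun a b => by
    rw [v_varpi_pow hϖ, v_varpi_pow hϖ, WithZero.exp_le_exp]; omega
  have hsv := v_diag_eq_one hvσ hE
  have hreg := diag_regular hE
  have hαv : Valued.v α = 1 := by simpa using hsv 0
  have hβv : Valued.v β = 1 := by simpa using hsv 1
  have hϖlt : Valued.v ϖ < 1 := by rw [hϖ, ← WithZero.exp_zero, WithZero.exp_lt_exp]; norm_num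
  -- isosceles: `min n₁ n₂ ≤ n₃`
  have hn₃min : min n₁ n₂ ≤ n₃ := by
    have h := Valuation.map_sub Valued.v (β - 1) (α - 1)
    rw [hγ', hβ, hα, le_max_iff, hpw, hpw] at h
    omega
  have hA2 : Valued.v ((α - 1) * (α - 1)) = Valued.v ϖ ^ (2 * n₂) := by rw [map_mul, hα, ← pow_add, two_mul]
  have hB2 : Valued.v ((β - 1) * (β - 1)) = Valued.v ϖ ^ (2 * n₁) := by rw [map_mul, hβ, ← pow_add, two_mul]
  rw [hmcv] at hmc
  intro M hM
  rw [stratum_G1_eq hvσ hfix hϖ T hρ hs] at hM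
  obtain ⟨x, ζ, y'', hx, hζ, hy, rfl, hTM, -⟩ := hM
  have hdet : (!![1, 0, 0; x, ϖ ^ ρ, 0; x * ζ + y'', ϖ ^ ρ * ζ, ϖ ^ (2 * ρ + s)] : Matrix (Fin 3) (Fin 3) K).det ≠ 0 := by
    rw [Matrix.det_fin_three]; simp [hϖ0]
  have hgen := fun (ℓ : ℕ) (e : Fin 3 → K) => latticeInLevel_diagonal_latt_G1_iff hϖ0 ℓ ρ s e hx hζ y''
  by_cases hfoot : n₁ = n₂ + s
  · -- on the glue foot the cell puts the stratum inside level `ℓ₀ + 1`: not on the shell, and the read is false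
    have htok : LatticeInLevel ϖ (d % 2 + 1) (Matrix.diagonal ![α - 1, β - 1, 0])
        (latt (!![1, 0, 0; x, ϖ ^ ρ, 0; x * ζ + y'', ϖ ^ ρ * ζ, ϖ ^ (2 * ρ + s)] : Matrix (Fin 3) (Fin 3) K)) := by
      rw [hgen]
      simp only [Matrix.cons_val_zero, Matrix.cons_val_one, Matrix.cons_val_two, Matrix.tail_cons, Matrix.head_cons, zero_sub, mul_neg, neg_mul, Valuation.map_neg, map_zero, zero_le, and_true]
      refine ⟨⟨?_, ?_⟩, ?_, ?_, ?_⟩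
      · rw [hα, hpw]; omega
      · rw [hβ, hpw]; omega
      · rw [hγ', hpw]; omega
      · rw [hβ, hpw]; omega
      · refine (Valuation.map_add _ _ _).trans (max_le ?_ ?_)
        · rw [Valuation.map_neg, map_mul, map_mul, hx, hζ, one_mul, one_mul, hβ, hpw]; omega
        · rw [Valuation.map_neg, map_mul, hα, hy, ← pow_add, hpw]; omega
    constructor
    · rintro ⟨-, h, -⟩; exact absurd htok h
    · intro h; omega
  · -- off the foot: stability gives the tube inequalities; the tokens read constants; the square token holds
    obtain ⟨h2ρs, -⟩ := depths_of_mapGL_latt_hnf_glued_eq hϖ0 hϖlt hαv hβv T hT hβ hα ρ s hfoot hx hζ hy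
      (Matrix.GeneralLinearGroup.mkOfDetNeZero _ hdet) rfl hTM
    have hsq : LatticeInLevel ϖ (mcOfRecord d) (Matrix.diagonal ![(α - 1) * (α - 1), (β - 1) * (β - 1), 0])
        (latt (!![1, 0, 0; x, ϖ ^ ρ, 0; x * ζ + y'', ϖ ^ ρ * ζ, ϖ ^ (2 * ρ + s)] : Matrix (Fin 3) (Fin 3) K)) := by
      rw [hmcv, hgen]
      simp only [Matrix.cons_val_zero, Matrix.cons_val_one, Matrix.cons_val_two, Matrix.tail_cons, Matrix.head_cons, zero_sub, mul_neg, neg_mul, Valuation.map_neg, map_zero, zero_le, and_true]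
      refine ⟨⟨?_, ?_⟩, ?_, ?_, ?_⟩
      · rw [hA2, hpw]; omega
      · rw [hB2, hpw]; omega
      · refine (Valuation.map_sub _ _ _).trans (max_le ?_ ?_)
        · rw [hB2, hpw]; omega
        · rw [hA2, hpw]; omega
      · rw [hB2, hpw]; omega
      · refine (Valuation.map_add _ _ _).trans (max_le ?_ ?_)
        · rw [Valuation.map_neg, map_mul, map_mul, hx, hζ, one_mul, one_mul, hB2, hpw]; omega
        · rw [Valuation.map_neg, map_mul, hA2, hy, ← pow_add, hpw]; omega
    have hne : Valued.v ((![α - 1, β - 1, 0] : Fin 3 → K) 2 - (![α - 1, β - 1, 0] : Fin 3 → K) 1) ≠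
        Valued.v ((![α - 1, β - 1, 0] : Fin 3 → K) 2 - (![α - 1, β - 1, 0] : Fin 3 → K) 0) * Valued.v ϖ ^ s := by
      simp only [Matrix.cons_val_zero, Matrix.cons_val_one, Matrix.cons_val_two, Matrix.tail_cons, Matrix.head_cons, zero_sub, Valuation.map_neg, hα, hβ, ← pow_add]
      rw [v_varpi_pow hϖ, v_varpi_pow hϖ, Ne, WithZero.exp_inj]; omega
    rw [latticeInLevel_diagonal_latt_G1_iff_of_ne hϖ0 (d % 2) ρ s _ hx hζ hy hne, latticeInLevel_diagonal_latt_G1_iff_of_ne hϖ0 (d % 2 + 1) ρ s _ hx hζ hy hne]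
    simp only [Matrix.cons_val_zero, Matrix.cons_val_one, Matrix.cons_val_two, Matrix.tail_cons, Matrix.head_cons, zero_sub, Valuation.map_neg, hv0, and_true, r2, r3, hsq, hα, ← pow_add, hpw]
    constructor
    · rintro ⟨⟨-, -, -, h1, -⟩, h2⟩; omega
    · intro h; refine ⟨⟨⟨by omega, by omega⟩, by omega, by omega, by omega, by omega⟩, fun h' => by omega⟩


omit [CompleteSpace K] [Fintype 𝓀[K]] in
/-- **THE TUBE INEQUALITIES ON THE READ** (token-free): in the one-slot cell, a member of `(2ρ, 2ρ+s, 2ρ+s)` with `2ρ + s + ℓ₀ = n₁` is off the glue foot, so stability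
gives `2ρ + s ≤ n₁`, `2ρ ≤ n₂` (★ `depths_of_mapGL_latt_hnf_glued_eq`) and `2ρ ≤ n₃` (isosceles `min n₁ n₂ ≤ n₃`). [cite: Kottwitz1986BaseChangeUnits, §1 pp. 240–241] -/
theorem tube_of_mem_stratum_G1 (hD : IsRamifiedQuadraticDatum σ ϖ d t)
    (hE : IsElementDatum σ ϖ N₀ α β n₁ n₂ n₃) (T : GL (Fin 3) K) (hT : (T : Matrix (Fin 3) (Fin 3) K) = Matrix.diagonal ![α, β, 1])
    (ρ s : ℕ) (hρ : 1 ≤ ρ) (hs : 1 ≤ s) (hcell : 2 * ρ + mstarOfRecord d ≤ n₂) (hP : 2 * ρ + s + d % 2 = n₁)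
    {M : Submodule 𝒪[K] (Fin 3 → K)} (hM : M ∈ stratum σ ϖ T ![2 * ρ, 2 * ρ + s, 2 * ρ + s]) :
    2 * ρ + s ≤ n₁ ∧ 2 * ρ ≤ n₂ ∧ 2 * ρ ≤ n₃ := by
  have hD' := hD
  obtain ⟨hσ, hvσ, hϖ, hfix, -, hd1, -⟩ := hD'
  have hϖ0 : ϖ ≠ 0 := fun h0 => by rw [h0, map_zero] at hϖ; exact WithZero.coe_ne_zero hϖ.symm
  have hϖlt : Valued.v ϖ < 1 := by rw [hϖ, ← WithZero.exp_zero, WithZero.exp_lt_exp]; norm_num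
  have hα : Valued.v (α - 1) = Valued.v ϖ ^ n₂ := hE.2.2.2.2.2.2.1
  have hβ : Valued.v (β - 1) = Valued.v ϖ ^ n₁ := hE.2.2.2.2.2.1
  have hγ : Valued.v (α - β) = Valued.v ϖ ^ n₃ := hE.2.2.2.2.2.2.2.1
  have hγ' : Valued.v (β - 1 - (α - 1)) = Valued.v ϖ ^ n₃ := by rw [show β - 1 - (α - 1) = -(α - β) by ring, Valuation.map_neg, hγ]
  have hmsv : mstarOfRecord d = d % 2 + 2 * d - 1 := rfl
  rw [hmsv] at hcell
  have hpw : ∀ a b : ℕ, Valued.v ϖ ^ a ≤ Valued.v ϖ ^ b ↔ b ≤ a := fun a b => by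
    rw [v_varpi_pow hϖ, v_varpi_pow hϖ, WithZero.exp_le_exp]; omega
  have hn₃min : min n₁ n₂ ≤ n₃ := by
    have h := Valuation.map_sub Valued.v (β - 1) (α - 1)
    rw [hγ', hβ, hα, le_max_iff, hpw, hpw] at h
    omega
  have hsv := v_diag_eq_one hvσ hE
  have hαv : Valued.v α = 1 := by simpa using hsv 0
  have hβv : Valued.v β = 1 := by simpa using hsv 1
  rw [stratum_G1_eq hvσ hfix hϖ T hρ hs] at hM
  obtain ⟨x, ζ, y'', hx, hζ, hy, rfl, hTM, -⟩ := hM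
  have hdet : (!![1, 0, 0; x, ϖ ^ ρ, 0; x * ζ + y'', ϖ ^ ρ * ζ, ϖ ^ (2 * ρ + s)] : Matrix (Fin 3) (Fin 3) K).det ≠ 0 := by
    rw [Matrix.det_fin_three]; simp [hϖ0]
  have hfoot : n₁ ≠ n₂ + s := by omega
  obtain ⟨h1, h2⟩ := depths_of_mapGL_latt_hnf_glued_eq hϖ0 hϖlt hαv hβv T hT hβ hα ρ s hfoot hx hζ hy
    (Matrix.GeneralLinearGroup.mkOfDetNeZero _ hdet) rfl hTM
  exact ⟨h1, h2, by omega⟩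

omit [CompleteSpace K] [Fintype 𝓀[K]] in
/-- **`G₁` OFF THE READ, TOKEN-FREE** (LH4-p05 (g8) parity ask): in the one-slot cell, if `¬ (2ρ + s + ℓ₀ = n₁ ∧ 2 ∣ s ∧ 2ρ ≤ min n₂ n₃)` the clean-shell cut of the stratum
`(2ρ, 2ρ+s, 2ρ+s)` carries labelled odd value `0` in every slot (read false ⇒ empty cut; odd `s` ⇒ empty stratum, ★; tube violated ⇒ empty stratum by the tube inequalities).
[cite: Kottwitz1986BaseChangeUnits, §1 pp. 240–241] [cite: Rogawski1990, §4.9 Prop. 4.9.1 (a) p. 55] -/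
theorem finsum_stratum_G1_shell_labelledOdd_div_relIndex_eq_zero_of_not (hD : IsRamifiedQuadraticDatum σ ϖ d t) (h2d : 2 ≤ d)
    (hE : IsElementDatum σ ϖ N₀ α β n₁ n₂ n₃) (hmc : mcOfRecord d ≤ N₀)
    (T : GL (Fin 3) K) (hT : (T : Matrix (Fin 3) (Fin 3) K) = Matrix.diagonal ![α, β, 1]) (ρ s : ℕ) (hρ : 1 ≤ ρ) (hs : 1 ≤ s)
    (hcell : 2 * ρ + mstarOfRecord d ≤ n₂) (hnot : ¬ (2 * ρ + s + d % 2 = n₁ ∧ 2 ∣ s ∧ 2 * ρ ≤ min n₂ n₃)) (i : Fin 3) :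
    ∑ᶠ M ∈ {M : Submodule 𝒪[K] (Fin 3 → K) | M ∈ stratum σ ϖ T ![2 * ρ, 2 * ρ + s, 2 * ρ + s] ∧
        (LatticeInLevel ϖ (d % 2) (Matrix.diagonal ![α - 1, β - 1, 0]) M ∧ ¬ LatticeInLevel ϖ (d % 2 + 1) (Matrix.diagonal ![α - 1, β - 1, 0]) M ∧
          LatticeInLevel ϖ (mcOfRecord d) (Matrix.diagonal ![(α - 1) * (α - 1), (β - 1) * (β - 1), 0]) M)},
      (labelledOddCount σ ϖ 0 i (valueClassLabel σ ϖ (α - 1) (β - 1) (mstarOfRecord d) d) M : ℚ) /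
        ((((unitStabilizer M).map (unitNormMap σ 3)).relIndex (fixedUnitTorus σ 3) : ℕ) : ℚ) = 0 := by
  classical
  have hD' := hD
  obtain ⟨hσ, hvσ, hϖ, hfix, -, -, -⟩ := hD'
  rw [finsum_mem_sep_eq_ite_of_forall_iff (stratum σ ϖ T ![2 * ρ, 2 * ρ + s, 2 * ρ + s]) _ _
    (shell_iff_of_mem_stratum_G1 hD h2d hE hmc T hT ρ s hρ hs hcell)]
  by_cases hP : 2 * ρ + s + d % 2 = n₁
  · rw [if_pos hP]
    have hzero : ∀ M ∈ stratum σ ϖ T ![2 * ρ, 2 * ρ + s, 2 * ρ + s],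
        (labelledOddCount σ ϖ 0 i (valueClassLabel σ ϖ (α - 1) (β - 1) (mstarOfRecord d) d) M : ℚ) /
            ((((unitStabilizer M).map (unitNormMap σ 3)).relIndex (fixedUnitTorus σ 3) : ℕ) : ℚ) = 0 := by
      intro M hM
      have h2s := two_dvd_of_mem_stratum_G1 hvσ hfix hϖ T hρ hs hM
      obtain ⟨h1, h2, h3⟩ := tube_of_mem_stratum_G1 hD hE T hT ρ s hρ hs hcell hP hM
      exact absurd ⟨hP, h2s, le_min h2 h3⟩ hnot
    rw [finsum_mem_congr rfl hzero]
    simp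
  · rw [if_neg hP]


/-- **THE `G₁ = (2ρ, 2ρ+s, 2ρ+s)` STRATUM ON THE CLEAN SHELL, ONE-SLOT CELL** (`ρ, s ≥ 1`; `2 ≤ d ≤ N₀`, `mcOfRecord d ≤ N₀`, `|2| < 1`; cell `2ρ + m* ≤ n₂`; token `e_B` of `β − 1`):
`Σᶠ_{M ∈ stratum G₁, shell} labelledOddCount σ ϖ 0 i Λ M ∕ [𝒰 : N(S̃′(M))] = [2ρ + s + ℓ₀ = n₁ ∧ 2 ∣ s ∧ 2ρ ≤ min n₂ n₃] · ω(e_B)∕2 ·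
(0, (q−1)·q^{2ρ+s∕2−1}, ω(−1)·q^{2ρ+s∕2−1}·((q−1)·[2d ≤ s] − [s+2 = 2d]))_i` — FILE 2a over ★ κG1 ∕ ★ B56 behind the constant shell read.
[cite: Kottwitz1986BaseChangeUnits, §1 pp. 240–241] [cite: Rogawski1990, §4.9 Prop. 4.9.1 (a)(b) p. 55, §4.10 p. 58] [cite: LanglandsShelstad1987, §3] -/
theorem finsum_stratum_G1_shell_labelledOdd_div_relIndex_eq (hD : IsRamifiedQuadraticDatum σ ϖ d t) (h2 : Valued.v (2 : K) < 1) (h2d : 2 ≤ d)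
    (hE : IsElementDatum σ ϖ N₀ α β n₁ n₂ n₃) (hN₀ : d ≤ N₀) (hmc : mcOfRecord d ≤ N₀)
    (T : GL (Fin 3) K) (hT : (T : Matrix (Fin 3) (Fin 3) K) = Matrix.diagonal ![α, β, 1]) (ρ s : ℕ) (hρ : 1 ≤ ρ) (hs : 1 ≤ s)
    (hcell : 2 * ρ + mstarOfRecord d ≤ n₂)
    {eB : K} (hσeB : σ eB = eB) (heB1 : Valued.v eB = 1)
    (heB : Valued.v ((ϖ ^ mstarOfRecord d)⁻¹ * ((β - 1) * ((ϖ * σ ϖ) ^ ((n₁ - d % 2) / 2))⁻¹ - eB * ((ϖ - σ ϖ) * ((ϖ * σ ϖ) ^ ((d - d % 2) / 2))⁻¹))) ≤ 1)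
    (i : Fin 3) :
    ∑ᶠ M ∈ {M : Submodule 𝒪[K] (Fin 3 → K) | M ∈ stratum σ ϖ T ![2 * ρ, 2 * ρ + s, 2 * ρ + s] ∧
        (LatticeInLevel ϖ (d % 2) (Matrix.diagonal ![α - 1, β - 1, 0]) M ∧ ¬ LatticeInLevel ϖ (d % 2 + 1) (Matrix.diagonal ![α - 1, β - 1, 0]) M ∧
          LatticeInLevel ϖ (mcOfRecord d) (Matrix.diagonal ![(α - 1) * (α - 1), (β - 1) * (β - 1), 0]) M)},
      (labelledOddCount σ ϖ 0 i (valueClassLabel σ ϖ (α - 1) (β - 1) (mstarOfRecord d) d) M : ℚ) /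
        ((((unitStabilizer M).map (unitNormMap σ 3)).relIndex (fixedUnitTorus σ 3) : ℕ) : ℚ) =
      if 2 * ρ + s + d % 2 = n₁ ∧ 2 ∣ s ∧ 2 * ρ ≤ min n₂ n₃ then
        (normSign σ eB : ℚ) / 2 *
          (![(0 : ℚ), ((Fintype.card 𝓀[K] : ℚ) - 1) * (Fintype.card 𝓀[K] : ℚ) ^ (2 * ρ + s / 2 - 1),
              (normSign σ (-1 : K) : ℚ) * (Fintype.card 𝓀[K] : ℚ) ^ (2 * ρ + s / 2 - 1) *
                ((if 2 * d ≤ s then (Fintype.card 𝓀[K] : ℚ) - 1 else 0) - (if s + 2 = 2 * d then 1 else 0))] : Fin 3 → ℚ) i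
      else 0 := by
  classical
  have hD' := hD
  obtain ⟨hσ, hvσ, hϖ, hfix, -, -, -⟩ := hD'
  have hϖ0 : ϖ ≠ 0 := fun h0 => by rw [h0, map_zero] at hϖ; exact WithZero.coe_ne_zero hϖ.symm
  have hα : Valued.v (α - 1) = Valued.v ϖ ^ n₂ := hE.2.2.2.2.2.2.1
  have hn₁ : N₀ ≤ n₁ := hE.2.2.2.2.2.2.2.2.1
  have hn₂ : N₀ ≤ n₂ := hE.2.2.2.2.2.2.2.2.2.1
  have hmcv : mcOfRecord d = 2 * ((d % 2 + 2 * d - 1 + d) / 2) := rfl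
  have hmsv : mstarOfRecord d = d % 2 + 2 * d - 1 := rfl
  have hread := shell_iff_of_mem_stratum_G1 hD h2d hE hmc T hT ρ s hρ hs hcell
  have hcell' := hcell
  rw [hmsv] at hcell'
  have hsv := v_diag_eq_one hvσ hE
  have hreg := diag_regular hE
  by_cases hcond : 2 * ρ + s + d % 2 = n₁ ∧ 2 ∣ s ∧ 2 * ρ ≤ min n₂ n₃
  swap
  · rw [if_neg hcond]
    exact finsum_stratum_G1_shell_labelledOdd_div_relIndex_eq_zero_of_not hD h2d hE (by omega) T hT ρ s hρ hs hcell hcond i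
  obtain ⟨hP, ⟨j', hj'⟩, hc⟩ := hcond
  rw [if_pos ⟨hP, Dvd.intro j' hj'.symm, hc⟩, finsum_mem_sep_eq_ite_of_forall_iff (stratum σ ϖ T ![2 * ρ, 2 * ρ + s, 2 * ρ + s]) _ _ hread, if_pos hP]
  -- the half-depth of the dominant slot
  set j : ℕ := ρ + j' with hjdef
  have hjs : 2 * j = 2 * ρ + s := by omega
  have hjn : (n₁ - d % 2) / 2 = j := by omega
  rw [hjn] at heB
  -- pointwise: FILE 2a on every member
  have hval : ∀ M ∈ stratum σ ϖ T ![2 * ρ, 2 * ρ + s, 2 * ρ + s],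
      (labelledOddCount σ ϖ 0 i (valueClassLabel σ ϖ (α - 1) (β - 1) (mstarOfRecord d) d) M : ℚ) /
          ((((unitStabilizer M).map (unitNormMap σ 3)).relIndex (fixedUnitTorus σ 3) : ℕ) : ℚ) =
        (normSign σ eB : ℚ) / 2 * ((((![kappaCount σ ϖ 0 2 M, 1, kappaCount σ ϖ 0 0 M] : Fin 3 → ℤ) i) : ℤ) : ℚ) * stabiliserWeight σ M := by
    intro M hM
    have hM' := hM
    rw [stratum_G1_eq hvσ hfix hϖ T hρ hs] at hM'
    obtain ⟨x, ζ, y'', hx, hζ, hy, hMe, -, ⟨D₁, hD₁, hV₁⟩⟩ := hM'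
    obtain ⟨⟨g, hg⟩, -, hnorm⟩ := hM.1
    have hnorm' := hnorm
    have hV₁' := hV₁
    rw [hMe] at hnorm' hV₁'
    obtain ⟨hvD0, hvD1⟩ := v_polarisation_latt_G1 hvσ hϖ (fun k => (hD₁ k).2) hρ hs hx hζ hy hnorm' hV₁'
    -- slot `0` is small: `|D₀·(α−1)| = |ϖ|^{n₂ − 2ρ} ≤ |ϖ|^{m*}`
    have hsmall : ∀ w ∈ M, Valued.v ((ϖ ^ (d % 2 + 2 * d - 1))⁻¹ * (D₁ 0 * (α - 1) * (w 0 * σ (w 0)))) ≤ 1 := by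
      intro w hw
      have hw0 : Valued.v (w 0) ≤ 1 := (hnorm 0).1 w hw
      have hm0 : Valued.v (ϖ ^ (d % 2 + 2 * d - 1)) ≠ 0 := (Valuation.ne_zero_iff _).2 (pow_ne_zero _ hϖ0)
      have hDA : Valued.v (D₁ 0) * Valued.v (α - 1) ≤ Valued.v (ϖ ^ (d % 2 + 2 * d - 1)) := by
        rw [hvD0, hα, v_varpi_pow hϖ, ← WithZero.exp_add, map_pow, v_varpi_pow hϖ, WithZero.exp_le_exp]; push_cast; omega
      rw [map_mul, map_inv₀, map_mul, map_mul, map_mul, hvσ]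
      calc (Valued.v (ϖ ^ (d % 2 + 2 * d - 1)))⁻¹ * (Valued.v (D₁ 0) * Valued.v (α - 1) * (Valued.v (w 0) * Valued.v (w 0)))
          ≤ (Valued.v (ϖ ^ (d % 2 + 2 * d - 1)))⁻¹ * (Valued.v (ϖ ^ (d % 2 + 2 * d - 1)) * (1 * 1)) := by gcongr
        _ = 1 := by rw [mul_one, mul_one, inv_mul_cancel₀ hm0]
    have hvD1' : Valued.v (D₁ 1 * (ϖ * σ ϖ) ^ j) = 1 := by
      rw [map_mul, hvD1, map_pow, map_mul, hvσ, ← pow_two, ← pow_mul, v_varpi_pow hϖ, ← WithZero.exp_add, ← WithZero.exp_zero]; congr 1; push_cast; omega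
    have h := labelledOddCount_div_relIndex_eq_normSign_mul_kappaCount_of_fst_small hD (α - 1) (β - 1) g hg hnorm
      (finite_unitTorus_orbit_of_mem_normalisedStableLattices hϖ hsv hreg T hT hM.1) hD₁ hV₁ hsmall j hvD1' hσeB heB1 heB i
    rw [hmsv, h]
  rw [finsum_mem_congr rfl hval]
  -- the three slots over ★ κG1 ∕ ★ B56 (glue branch void: `n₁ < n₂ + s` in the cell)
  have hng : ¬ (2 ∣ s ∧ n₂ = n₃ ∧ n₁ = n₂ + s ∧ n₂ < 2 * ρ ∧ 2 * ρ - n₂ ≤ n₂ - d + 1) := fun h => by omega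
  have hglue : 2 ∣ s → n₂ = n₃ → n₁ = n₂ + s → n₂ < 2 * ρ → 2 * ρ - n₂ ≤ n₂ - d + 1 → Valued.v ((0 : K) + (β - 1) / (α - 1)) ≤ Valued.v ϖ ^ (2 * ρ + s - n₂) :=
    fun _ _ h3 _ _ => by omega
  have hκ0 := finsum_kappaCount_mul_stabiliserWeight_hasAxis_G1 hD h2 hE hN₀ hT ρ s hρ hs 0 0 (map_zero σ) hglue
  have hκ2 := finsum_kappaCount_mul_stabiliserWeight_hasAxis_G1 hD h2 hE hN₀ hT ρ s hρ hs 2 0 (map_zero σ) hglue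
  have hsw := finsum_stabiliserWeight_hasAxis_G1 hD h2 hE hN₀ hT ρ s hρ hs
  rw [if_neg hng, add_zero] at hκ0 hκ2 hsw
  have e2s : s / 2 = j' := by omega
  by_cases hi0 : i = 0
  · -- own slot `0`: the `κ₂`-weighted G1 socket vanishes on the tube
    subst hi0
    have hpt : ∀ M ∈ stratum σ ϖ T ![2 * ρ, 2 * ρ + s, 2 * ρ + s],
        (normSign σ eB : ℚ) / 2 * ((((![kappaCount σ ϖ 0 2 M, 1, kappaCount σ ϖ 0 0 M] : Fin 3 → ℤ) 0) : ℤ) : ℚ) * stabiliserWeight σ M =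
          (normSign σ eB : ℚ) / 2 * ((kappaCount σ ϖ 0 2 M : ℚ) * stabiliserWeight σ M) := fun M _ => by
      simp only [Matrix.cons_val_zero]; ring
    rw [finsum_mem_congr rfl hpt, ← mul_finsum_mem, hκ2]
    rw [if_pos (show 2 ∣ s ∧ 2 * ρ ≤ min n₂ n₃ ∧ 2 * ρ + s ≤ n₁ from ⟨Dvd.intro j' hj'.symm, hc, by omega⟩)]
    simp
  by_cases hi1 : i = 1
  · -- dominant slot `1`: the plain orbit count
    subst hi1
    have hpt : ∀ M ∈ stratum σ ϖ T ![2 * ρ, 2 * ρ + s, 2 * ρ + s],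
        (normSign σ eB : ℚ) / 2 * ((((![kappaCount σ ϖ 0 2 M, 1, kappaCount σ ϖ 0 0 M] : Fin 3 → ℤ) 1) : ℤ) : ℚ) * stabiliserWeight σ M =
          (normSign σ eB : ℚ) / 2 * stabiliserWeight σ M := fun M _ => by
      simp only [Matrix.cons_val_one, Matrix.cons_val_zero]; push_cast; ring
    rw [finsum_mem_congr rfl hpt, ← mul_finsum_mem, hsw]
    rw [if_pos (show 2 ∣ s ∧ 2 * ρ ≤ min n₂ n₃ ∧ 2 * ρ + s ≤ n₁ from ⟨Dvd.intro j' hj'.symm, hc, by omega⟩)]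
    simp [e2s]
  · -- third slot `2`: the `κ₀`-weighted G1 socket
    obtain rfl : i = 2 := by
      fin_cases i
      · exact absurd rfl hi0
      · exact absurd rfl hi1
      · rfl
    have hpt : ∀ M ∈ stratum σ ϖ T ![2 * ρ, 2 * ρ + s, 2 * ρ + s],
        (normSign σ eB : ℚ) / 2 * ((((![kappaCount σ ϖ 0 2 M, 1, kappaCount σ ϖ 0 0 M] : Fin 3 → ℤ) 2) : ℤ) : ℚ) * stabiliserWeight σ M =
          (normSign σ eB : ℚ) / 2 * ((kappaCount σ ϖ 0 0 M : ℚ) * stabiliserWeight σ M) := fun M _ => by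
      simp only [Matrix.cons_val_two, Matrix.tail_cons, Matrix.head_cons]; ring
    rw [finsum_mem_congr rfl hpt, ← mul_finsum_mem, hκ0]
    rw [if_pos (show 2 ∣ s ∧ 2 * ρ ≤ min n₂ n₃ ∧ 2 * ρ + s ≤ n₁ from ⟨Dvd.intro j' hj'.symm, hc, by omega⟩)]
    simp [e2s]


end Strata

end Summit.HodgeConjecture.HodgeConjecture.Cruxes.H413.F0P3cDyRamLabelledOddPureStrataG1

end
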